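import Summits.HodgeConjecture.HodgeConjecture.Theorems.Ring2WeilCoverageWeilGramLevel36Principal
import Summits.HodgeConjecture.HodgeConjecture.Theorems.Ring2WeilCoverageWeilGramLevel36TypeABExists
import HarnessLib

/-!
# Weil-type family coverage — THE COMPONENTS OF THE WEIL-TYPE `ℤ[ζ₃₆]`-SIXFOLDS, VII: the PRODUCT type `𝔮₃𝔮₂`
# (`𝔬𝔣₀ = (π_Aπ_B)`, degree `24`; reference parameter `ϖ_ABξ`, `ϖ_AB = π_Aπ_B = −1 + 2ζ³ − 2ζ⁷ + 2ζ⁸ − ζ⁹ − 2ζ¹⁰ + 2ζ¹¹`)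
# against `i = ζ⁹`: Gram determinant `−1536 = −6·16²` — class `[−3]`, `T = {2, 3}`: **pub-hsemireg's row R3 = (3, ℚ(i), 3)
# carries the type-`𝔮₃𝔮₂` polarised Weil-type `ℤ[ζ₃₆]`-CM sixfolds of EVERY `ℚ(i)`-balanced CM type**

research route conditional on HC_CM; not a corollary; Q11.4-sentence-2 already refuted in dim ≥ 3.

Ring 2, WEIL-TYPE FAMILY-COVERAGE CENSUS (`HOME/WEIL-FAMILY-COVERAGE.md` `## b01`, block b01.41 (C) «`a = 24 ≡ 3`,
`T = {2,3}` for the type `𝔮₂𝔮₃` … = b01.17's `A′₃₆` on **R3 = `(3, ℚ(i), 3)`**», S-pencil there; b01.16 (E): R3's CM point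
of record), part 116 of the `Ring2WeilCoverage*` series; continues parts 109/110 (frame, basis, `i = ζ⁹`) and part 115
(`Ring2WeilCoverageWeilGramLevel36TypeABExists`: the type EXISTS on every `ℚ(i)`-balanced `Φ`; `ϖ_AB = π_Aπ_B` reduced).

* §2 the eleven traces `Tr(ϖ_ABξ i θ^m)` and **`det a(ϖ_ABξ) = −1536 = −6·16²`** (`= N(π_A)N(π_B)·(−64) = 24·(−64)`).
* §3 **for EVERY skew `ζ′` of type `(π_Aπ_B)` on `ℤ[ζ₃₆]` the determinant is `−1536`** (part 82 + part 53 + THEOREM L (i)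
  at `36`); CENSUS FORM (part 115's existence + determinant); class **`[−1536] = [−3]`** (`3/1536 = (1/32)² + (1/32)²`)
  **`≠ splitDiscriminantClass 3 1`** (ring2-b02's R3 key `negThree_ne_split_three_one`; `T(3) = {2, 3}`): **the type-`𝔮₃𝔮₂`
  (degree `24`) polarised Weil-type `ℤ[ζ₃₆]`-CM sixfolds lie on the NON-SPLIT component R3 = `(3, ℚ(i), 3)`** — an
  explicit `𝒪_L`-linearly polarised CM point of Weil type on pub-hsemireg's row R3 for each of the twenty `ℚ(i)`-balanced
  CM types of `ℚ(ζ₃₆)` (b01.17's `A′₃₆` with `(1,1,1,2,2,6)` is one), right sign `(−1)³ det a > 0`.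

HONEST FRAMING as parts 109–115; `HC_CM` is used nowhere.  No `def`, no named fact, no `sorry`.  Certificates from
`work/py/gen6.py` + `lev36.py`, re-verified by `linear_combination`.

References: [cite: vanGeemen1994HodgeAV, Lemma 5.2 (2)–(4), 5.4 and (5.4.1)]; [cite: Shimura1998, §14.3 Prop. 4–5,
pp. 103–104]; [cite: Serre1973, Ch. III §1]; census b01.16 (E), b01.17, b01.41 (C) (seat-derived).
-/

noncomputable section

open Polynomial NumberField Module
open scoped nonZeroDivisors

namespace Summit.HodgeConjecture.Ring2WeilCoverage.WeilGramLevel36TypeAB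

open Literature.AlgebraicGeometry.VanGeemen1994 (weilField weilNormResidueGroup)
open Literature.AlgebraicGeometry.Motives (CMType normUnitsSubgroup)
open Literature.NumberTheory.ComplexMultiplication
open Summit.HodgeConjecture.Ring2WeilCoverage.TraceGramDeterminant (trace_aeval_zeta_mul_inv)
open Summit.HodgeConjecture.Ring2WeilCoverage.WeilGramCMPoint
open Summit.HodgeConjecture.Ring2WeilCoverage.RealUnitNormHalfSystems (complexConj_eq_inv)
open Summit.HodgeConjecture.Ring2WeilCoverage.CyclotomicPrincipalObstruction (complexConj_xi)
open Summit.HodgeConjecture.Ring2WeilCoverage.CyclotomicDifferent (isOfType_one_xi_top xi_ne_zero)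
open Summit.HodgeConjecture.HodgeConjecture.Ring2.WeilCoverage (mk_neg_eq_split_of_odd mk_neg_ne_split_of_odd
  mem_normUnitsSubgroup_of_sq_add_mul_sq)
open Summit.HodgeConjecture.HodgeConjecture.Ring2.Hypotheses (splitDiscriminantClass)
open Summit.HodgeConjecture.Ring2WeilCoverage.WeilGramLevel36
open Summit.HodgeConjecture.Ring2WeilCoverage.WeilGramLevel36Principal
open Summit.HodgeConjecture.Ring2WeilCoverage.WeilGramLevel36TypeABExists
open Summit.HodgeConjecture.Ring2WeilCoverage.CyclotomicUnconditional (norm_realUnits_pos_thirtySix)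
open Summit.HodgeConjecture.Ring2WeilCoverage.RealGeneratorTypes (isOfType_one_mul_xi complexConj_mul_xi)
variable {K : Type} [Field K] [NumberField K] {ζ : K}

/-- `𝐞(t) = exp(2πi t/n) ∈ ℂ` (`ZMod.toCircle`). -/
local notation3 (prettyPrint := false) "𝐞 " t:max => ((ZMod.toCircle t : Circle) : ℂ)

/-- the residue set `S_Φ` read at level `36`. -/
local notation3 (prettyPrint := false) "SΦ[" Φ "," z "]" =>
  (Finset.univ.filter fun t : ZMod 36 => ∃ σ ∈ (Φ : CMType K).1, σ (z : K) = 𝐞 t)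

/-! ### §2 Type `𝔮₃𝔮₂`: `ζ′ = ϖ_ABξ` against `i = ζ⁹` — eleven traces, `det a = −1536` -/

/-- `Tr(ζ′sθ^0) = 2` for `ζ′ = ϖ_ABξ, ϖ_AB = π_Aπ_B = −1 + 2ζ³ − 2ζ⁷ + 2ζ⁸ − ζ⁹ − 2ζ¹⁰ + 2ζ¹¹`, `s = √−1 = ζ⁹ = i`, `θ = ζ + ζ⁻¹` (Euler evaluation). research route conditional on HC_CM; not a corollary; Q11.4-sentence-2 already refuted in dim ≥ 3. [folklore] -/
theorem trace_varpiAB_sqrtNegOne_zero [IsCyclotomicExtension {36} ℚ K] (hζ : IsPrimitiveRoot ζ 36) :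
    Algebra.trace ℚ K (((-1 + 2 * ζ ^ 3 - 2 * ζ ^ 7 + 2 * ζ ^ 8 - ζ ^ 9 - 2 * ζ ^ 10 + 2 * ζ ^ 11) * (ζ ^ 5 * (aeval ζ (derivative (cyclotomic 36 ℚ)))⁻¹)) * (ζ ^ 9)) = 2 := by
  have hΦ := cyc_thirtySix hζ
  rw [trace_of_key₀ hζ (C (0 : ℚ) + C (0 : ℚ) * X + C (1 : ℚ) * X ^ 2 + C (2 : ℚ) * X ^ 3 + C (-2 : ℚ) * X ^ 4 +
      C (-1 : ℚ) * X ^ 5 + C (2 : ℚ) * X ^ 6 + C (-2 : ℚ) * X ^ 7 + C (-1 : ℚ) * X ^ 8 + C (0 : ℚ) * X ^ 9 +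
      C (0 : ℚ) * X ^ 10 + C (2 : ℚ) * X ^ 11) (by compute_degree) (by
    simp only [map_add, map_mul, map_pow, aeval_C, aeval_X, eq_ratCast]
    push_cast
    linear_combination ((aeval ζ (derivative (cyclotomic 36 ℚ)))⁻¹ * (-ζ^2 - 2 * ζ^3 + 2 * ζ^4 + ζ^5 - 2 * ζ^6 + 2 * ζ^7 - 2 * ζ^9 + 2 * ζ^10 -
        ζ^11 - 2 * ζ^12 + 2 * ζ^13)) * hΦ)]
  norm_num [coeff_X_pow, coeff_X, coeff_C, coeff_one]

/-- `Tr(ζ′sθ^1) = 0` for `ζ′ = ϖ_ABξ, ϖ_AB = π_Aπ_B = −1 + 2ζ³ − 2ζ⁷ + 2ζ⁸ − ζ⁹ − 2ζ¹⁰ + 2ζ¹¹`, `s = √−1 = ζ⁹ = i`, `θ = ζ + ζ⁻¹` (Euler evaluation). research route conditional on HC_CM; not a corollary; Q11.4-sentence-2 already refuted in dim ≥ 3. [folklore] -/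
theorem trace_varpiAB_sqrtNegOne_one [IsCyclotomicExtension {36} ℚ K] (hζ : IsPrimitiveRoot ζ 36) :
    Algebra.trace ℚ K (((-1 + 2 * ζ ^ 3 - 2 * ζ ^ 7 + 2 * ζ ^ 8 - ζ ^ 9 - 2 * ζ ^ 10 + 2 * ζ ^ 11) * (ζ ^ 5 * (aeval ζ (derivative (cyclotomic 36 ℚ)))⁻¹)) * (ζ ^ 9) * (ζ + ζ⁻¹)) = 0 := by
  have hΦ := cyc_thirtySix hζ
  rw [trace_of_key₁ hζ (C (-2 : ℚ) + C (1 : ℚ) * X + C (2 : ℚ) * X ^ 2 + C (-1 : ℚ) * X ^ 3 + C (1 : ℚ) * X ^ 4 +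
      C (0 : ℚ) * X ^ 5 + C (-1 : ℚ) * X ^ 6 + C (1 : ℚ) * X ^ 7 + C (-2 : ℚ) * X ^ 8 + C (-1 : ℚ) * X ^ 9 +
      C (2 : ℚ) * X ^ 10 + C (0 : ℚ) * X ^ 11) (by compute_degree) (by
    simp only [map_add, map_mul, map_pow, aeval_C, aeval_X, eq_ratCast]
    push_cast
    linear_combination ((aeval ζ (derivative (cyclotomic 36 ℚ)))⁻¹ * (2 * ζ - ζ^2 - 2 * ζ^3 + ζ^4 - ζ^5 + 3 * ζ^7 - 2 * ζ^8 + 2 * ζ^10 -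
        3 * ζ^11 + ζ^13 - 2 * ζ^14 + 2 * ζ^15)) * hΦ)]
  norm_num [coeff_X_pow, coeff_X, coeff_C, coeff_one]

/-- `Tr(ζ′sθ^2) = 4` for `ζ′ = ϖ_ABξ, ϖ_AB = π_Aπ_B = −1 + 2ζ³ − 2ζ⁷ + 2ζ⁸ − ζ⁹ − 2ζ¹⁰ + 2ζ¹¹`, `s = √−1 = ζ⁹ = i`, `θ = ζ + ζ⁻¹` (Euler evaluation). research route conditional on HC_CM; not a corollary; Q11.4-sentence-2 already refuted in dim ≥ 3. [folklore] -/
theorem trace_varpiAB_sqrtNegOne_two [IsCyclotomicExtension {36} ℚ K] (hζ : IsPrimitiveRoot ζ 36) :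
    Algebra.trace ℚ K (((-1 + 2 * ζ ^ 3 - 2 * ζ ^ 7 + 2 * ζ ^ 8 - ζ ^ 9 - 2 * ζ ^ 10 + 2 * ζ ^ 11) * (ζ ^ 5 * (aeval ζ (derivative (cyclotomic 36 ℚ)))⁻¹)) * (ζ ^ 9) * (ζ + ζ⁻¹) ^ 2) = 4 := by
  have hΦ := cyc_thirtySix hζ
  rw [trace_of_key hζ (C (1 : ℚ) + C (0 : ℚ) * X + C (0 : ℚ) * X ^ 2 + C (3 : ℚ) * X ^ 3 + C (-1 : ℚ) * X ^ 4 +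
      C (-2 : ℚ) * X ^ 5 + C (1 : ℚ) * X ^ 6 + C (-3 : ℚ) * X ^ 7 + C (0 : ℚ) * X ^ 8 + C (0 : ℚ) * X ^ 9 +
      C (-1 : ℚ) * X ^ 10 + C (4 : ℚ) * X ^ 11) (by compute_degree) (by
    simp only [map_add, map_mul, map_pow, aeval_C, aeval_X, eq_ratCast]
    push_cast
    linear_combination ((aeval ζ (derivative (cyclotomic 36 ℚ)))⁻¹ * (-ζ^2 - 3 * ζ^5 + ζ^6 + 2 * ζ^7 - 2 * ζ^8 + 3 * ζ^9 - 3 * ζ^11 + 2 * ζ^12 -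
        2 * ζ^13 - 2 * ζ^14 + 3 * ζ^15 - 2 * ζ^16 + 2 * ζ^17)) * hΦ)]
  norm_num [coeff_X_pow, coeff_X, coeff_C, coeff_one]

/-- `Tr(ζ′sθ^3) = -2` for `ζ′ = ϖ_ABξ, ϖ_AB = π_Aπ_B = −1 + 2ζ³ − 2ζ⁷ + 2ζ⁸ − ζ⁹ − 2ζ¹⁰ + 2ζ¹¹`, `s = √−1 = ζ⁹ = i`, `θ = ζ + ζ⁻¹` (Euler evaluation). research route conditional on HC_CM; not a corollary; Q11.4-sentence-2 already refuted in dim ≥ 3. [folklore] -/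
theorem trace_varpiAB_sqrtNegOne_three [IsCyclotomicExtension {36} ℚ K] (hζ : IsPrimitiveRoot ζ 36) :
    Algebra.trace ℚ K (((-1 + 2 * ζ ^ 3 - 2 * ζ ^ 7 + 2 * ζ ^ 8 - ζ ^ 9 - 2 * ζ ^ 10 + 2 * ζ ^ 11) * (ζ ^ 5 * (aeval ζ (derivative (cyclotomic 36 ℚ)))⁻¹)) * (ζ ^ 9) * (ζ + ζ⁻¹) ^ 3) = -2 := by
  have hΦ := cyc_thirtySix hζ
  rw [trace_of_key hζ (C (-4 : ℚ) + C (1 : ℚ) * X + C (3 : ℚ) * X ^ 2 + C (-1 : ℚ) * X ^ 3 + C (1 : ℚ) * X ^ 4 +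
      C (1 : ℚ) * X ^ 5 + C (-1 : ℚ) * X ^ 6 + C (1 : ℚ) * X ^ 7 + C (-3 : ℚ) * X ^ 8 + C (-1 : ℚ) * X ^ 9 +
      C (4 : ℚ) * X ^ 10 + C (-2 : ℚ) * X ^ 11) (by compute_degree) (by
    simp only [map_add, map_mul, map_pow, aeval_C, aeval_X, eq_ratCast]
    push_cast
    linear_combination ((aeval ζ (derivative (cyclotomic 36 ℚ)))⁻¹ * (4 * ζ^3 - ζ^4 - 3 * ζ^5 + ζ^6 - ζ^7 - ζ^8 + 5 * ζ^9 - 2 * ζ^10 +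
        2 * ζ^12 - 5 * ζ^13 + ζ^15 - 4 * ζ^16 + 5 * ζ^17 - 2 * ζ^18 + 2 * ζ^19)) * hΦ)]
  norm_num [coeff_X_pow, coeff_X, coeff_C, coeff_one]

/-- `Tr(ζ′sθ^4) = 8` for `ζ′ = ϖ_ABξ, ϖ_AB = π_Aπ_B = −1 + 2ζ³ − 2ζ⁷ + 2ζ⁸ − ζ⁹ − 2ζ¹⁰ + 2ζ¹¹`, `s = √−1 = ζ⁹ = i`, `θ = ζ + ζ⁻¹` (Euler evaluation). research route conditional on HC_CM; not a corollary; Q11.4-sentence-2 already refuted in dim ≥ 3. [folklore] -/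
theorem trace_varpiAB_sqrtNegOne_four [IsCyclotomicExtension {36} ℚ K] (hζ : IsPrimitiveRoot ζ 36) :
    Algebra.trace ℚ K (((-1 + 2 * ζ ^ 3 - 2 * ζ ^ 7 + 2 * ζ ^ 8 - ζ ^ 9 - 2 * ζ ^ 10 + 2 * ζ ^ 11) * (ζ ^ 5 * (aeval ζ (derivative (cyclotomic 36 ℚ)))⁻¹)) * (ζ ^ 9) * (ζ + ζ⁻¹) ^ 4) = 8 := by
  have hΦ := cyc_thirtySix hζ
  rw [trace_of_key hζ (C (3 : ℚ) + C (-1 : ℚ) * X + C (0 : ℚ) * X ^ 2 + C (4 : ℚ) * X ^ 3 + C (0 : ℚ) * X ^ 4 +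
      C (-4 : ℚ) * X ^ 5 + C (0 : ℚ) * X ^ 6 + C (-4 : ℚ) * X ^ 7 + C (0 : ℚ) * X ^ 8 + C (1 : ℚ) * X ^ 9 +
      C (-3 : ℚ) * X ^ 10 + C (8 : ℚ) * X ^ 11) (by compute_degree) (by
    simp only [map_add, map_mul, map_pow, aeval_C, aeval_X, eq_ratCast]
    push_cast
    linear_combination ((aeval ζ (derivative (cyclotomic 36 ℚ)))⁻¹ * (-3 * ζ^4 + ζ^5 - 4 * ζ^7 + 4 * ζ^9 - 3 * ζ^10 + 5 * ζ^11 - 5 * ζ^13 +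
        2 * ζ^14 - 4 * ζ^15 - 4 * ζ^16 + 6 * ζ^17 - 6 * ζ^18 + 7 * ζ^19 -
        2 * ζ^20 + 2 * ζ^21)) * hΦ)]
  norm_num [coeff_X_pow, coeff_X, coeff_C, coeff_one]

/-- `Tr(ζ′sθ^5) = -6` for `ζ′ = ϖ_ABξ, ϖ_AB = π_Aπ_B = −1 + 2ζ³ − 2ζ⁷ + 2ζ⁸ − ζ⁹ − 2ζ¹⁰ + 2ζ¹¹`, `s = √−1 = ζ⁹ = i`, `θ = ζ + ζ⁻¹` (Euler evaluation). research route conditional on HC_CM; not a corollary; Q11.4-sentence-2 already refuted in dim ≥ 3. [folklore] -/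
theorem trace_varpiAB_sqrtNegOne_five [IsCyclotomicExtension {36} ℚ K] (hζ : IsPrimitiveRoot ζ 36) :
    Algebra.trace ℚ K (((-1 + 2 * ζ ^ 3 - 2 * ζ ^ 7 + 2 * ζ ^ 8 - ζ ^ 9 - 2 * ζ ^ 10 + 2 * ζ ^ 11) * (ζ ^ 5 * (aeval ζ (derivative (cyclotomic 36 ℚ)))⁻¹)) * (ζ ^ 9) * (ζ + ζ⁻¹) ^ 5) = -6 := by
  have hΦ := cyc_thirtySix hζ
  rw [trace_of_key hζ (C (-9 : ℚ) + C (3 : ℚ) * X + C (3 : ℚ) * X ^ 2 + C (0 : ℚ) * X ^ 3 + C (0 : ℚ) * X ^ 4 + C (3 : ℚ) * X ^ 5 +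
      C (0 : ℚ) * X ^ 6 + C (0 : ℚ) * X ^ 7 + C (-3 : ℚ) * X ^ 8 + C (-3 : ℚ) * X ^ 9 + C (9 : ℚ) * X ^ 10 +
      C (-6 : ℚ) * X ^ 11) (by compute_degree) (by
    simp only [map_add, map_mul, map_pow, aeval_C, aeval_X, eq_ratCast]
    push_cast
    linear_combination ((aeval ζ (derivative (cyclotomic 36 ℚ)))⁻¹ * (9 * ζ^5 - 3 * ζ^6 - 3 * ζ^7 - 3 * ζ^10 + 9 * ζ^11 - 3 * ζ^12 + 2 * ζ^14 -
        9 * ζ^15 - 2 * ζ^16 + 2 * ζ^17 - 10 * ζ^18 + 13 * ζ^19 - 8 * ζ^20 +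
        9 * ζ^21 - 2 * ζ^22 + 2 * ζ^23)) * hΦ)]
  norm_num [coeff_X_pow, coeff_X, coeff_C, coeff_one]

/-- `Tr(ζ′sθ^6) = 18` for `ζ′ = ϖ_ABξ, ϖ_AB = π_Aπ_B = −1 + 2ζ³ − 2ζ⁷ + 2ζ⁸ − ζ⁹ − 2ζ¹⁰ + 2ζ¹¹`, `s = √−1 = ζ⁹ = i`, `θ = ζ + ζ⁻¹` (Euler evaluation). research route conditional on HC_CM; not a corollary; Q11.4-sentence-2 already refuted in dim ≥ 3. [folklore] -/
theorem trace_varpiAB_sqrtNegOne_six [IsCyclotomicExtension {36} ℚ K] (hζ : IsPrimitiveRoot ζ 36) :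
    Algebra.trace ℚ K (((-1 + 2 * ζ ^ 3 - 2 * ζ ^ 7 + 2 * ζ ^ 8 - ζ ^ 9 - 2 * ζ ^ 10 + 2 * ζ ^ 11) * (ζ ^ 5 * (aeval ζ (derivative (cyclotomic 36 ℚ)))⁻¹)) * (ζ ^ 9) * (ζ + ζ⁻¹) ^ 6) = 18 := by
  have h36 : ζ ^ 36 = 1 := hζ.pow_eq_one
  have hΦ := cyc_thirtySix hζ
  rw [trace_of_key hζ (C (9 : ℚ) + C (-6 : ℚ) * X + C (3 : ℚ) * X ^ 2 + C (3 : ℚ) * X ^ 3 + C (3 : ℚ) * X ^ 4 +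
      C (-9 : ℚ) * X ^ 5 + C (-3 : ℚ) * X ^ 6 + C (-3 : ℚ) * X ^ 7 + C (-3 : ℚ) * X ^ 8 + C (6 : ℚ) * X ^ 9 +
      C (-9 : ℚ) * X ^ 10 + C (18 : ℚ) * X ^ 11) (by compute_degree) (by
    simp only [map_add, map_mul, map_pow, aeval_C, aeval_X, eq_ratCast]
    push_cast
    linear_combination ((aeval ζ (derivative (cyclotomic 36 ℚ)))⁻¹ * (-2 + 2 * ζ - 11 * ζ^6 + 8 * ζ^7 - 3 * ζ^8 - 3 * ζ^9 - 3 * ζ^10 +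
        9 * ζ^11 - 6 * ζ^12 + 9 * ζ^13 - ζ^14 - 9 * ζ^15 - 7 * ζ^17 - 10 * ζ^18 +
        13 * ζ^19 - 18 * ζ^20 + 22 * ζ^21 - 10 * ζ^22 + 11 * ζ^23)) * hΦ +
      ((aeval ζ (derivative (cyclotomic 36 ℚ)))⁻¹ * (-2 + 2 * ζ)) * h36)]
  norm_num [coeff_X_pow, coeff_X, coeff_C, coeff_one]

/-- `Tr(ζ′sθ^7) = -18` for `ζ′ = ϖ_ABξ, ϖ_AB = π_Aπ_B = −1 + 2ζ³ − 2ζ⁷ + 2ζ⁸ − ζ⁹ − 2ζ¹⁰ + 2ζ¹¹`, `s = √−1 = ζ⁹ = i`, `θ = ζ + ζ⁻¹` (Euler evaluation). research route conditional on HC_CM; not a corollary; Q11.4-sentence-2 already refuted in dim ≥ 3. [folklore] -/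
theorem trace_varpiAB_sqrtNegOne_seven [IsCyclotomicExtension {36} ℚ K] (hζ : IsPrimitiveRoot ζ 36) :
    Algebra.trace ℚ K (((-1 + 2 * ζ ^ 3 - 2 * ζ ^ 7 + 2 * ζ ^ 8 - ζ ^ 9 - 2 * ζ ^ 10 + 2 * ζ ^ 11) * (ζ ^ 5 * (aeval ζ (derivative (cyclotomic 36 ℚ)))⁻¹)) * (ζ ^ 9) * (ζ + ζ⁻¹) ^ 7) = -18 := by
  have h36 : ζ ^ 36 = 1 := hζ.pow_eq_one
  have hΦ := cyc_thirtySix hζ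
  rw [trace_of_key hζ (C (-24 : ℚ) + C (12 : ℚ) * X + C (-3 : ℚ) * X ^ 2 + C (6 : ℚ) * X ^ 3 + C (-6 : ℚ) * X ^ 4 +
      C (9 : ℚ) * X ^ 5 + C (6 : ℚ) * X ^ 6 + C (-6 : ℚ) * X ^ 7 + C (3 : ℚ) * X ^ 8 + C (-12 : ℚ) * X ^ 9 +
      C (24 : ℚ) * X ^ 10 + C (-18 : ℚ) * X ^ 11) (by compute_degree) (by
    simp only [map_add, map_mul, map_pow, aeval_C, aeval_X, eq_ratCast]
    push_cast
    linear_combination ((aeval ζ (derivative (cyclotomic 36 ℚ)))⁻¹ * (-12 + 13 * ζ - 2 * ζ^2 + 2 * ζ^3 - 12 * ζ^6 + 37 * ζ^7 - 14 * ζ^8 +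
        5 * ζ^9 - 6 * ζ^10 + 6 * ζ^11 - 9 * ζ^12 + 18 * ζ^13 - 7 * ζ^14 - ζ^16 -
        16 * ζ^17 - 5 * ζ^19 - 28 * ζ^20 + 35 * ζ^21 - 28 * ζ^22 + 33 * ζ^23)) * hΦ +
      ((aeval ζ (derivative (cyclotomic 36 ℚ)))⁻¹ * (-12 + 13 * ζ - 2 * ζ^2 + 2 * ζ^3)) * h36)]
  norm_num [coeff_X_pow, coeff_X, coeff_C, coeff_one]

/-- `Tr(ζ′sθ^8) = 48` for `ζ′ = ϖ_ABξ, ϖ_AB = π_Aπ_B = −1 + 2ζ³ − 2ζ⁷ + 2ζ⁸ − ζ⁹ − 2ζ¹⁰ + 2ζ¹¹`, `s = √−1 = ζ⁹ = i`, `θ = ζ + ζ⁻¹` (Euler evaluation). research route conditional on HC_CM; not a corollary; Q11.4-sentence-2 already refuted in dim ≥ 3. [folklore] -/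
theorem trace_varpiAB_sqrtNegOne_eight [IsCyclotomicExtension {36} ℚ K] (hζ : IsPrimitiveRoot ζ 36) :
    Algebra.trace ℚ K (((-1 + 2 * ζ ^ 3 - 2 * ζ ^ 7 + 2 * ζ ^ 8 - ζ ^ 9 - 2 * ζ ^ 10 + 2 * ζ ^ 11) * (ζ ^ 5 * (aeval ζ (derivative (cyclotomic 36 ℚ)))⁻¹)) * (ζ ^ 9) * (ζ + ζ⁻¹) ^ 8) = 48 := by
  have h36 : ζ ^ 36 = 1 := hζ.pow_eq_one
  have hΦ := cyc_thirtySix hζ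
  rw [trace_of_key hζ (C (30 : ℚ) + C (-27 : ℚ) * X + C (18 : ℚ) * X ^ 2 + C (-9 : ℚ) * X ^ 3 + C (15 : ℚ) * X ^ 4 +
      C (-24 : ℚ) * X ^ 5 + C (-15 : ℚ) * X ^ 6 + C (9 : ℚ) * X ^ 7 + C (-18 : ℚ) * X ^ 8 + C (27 : ℚ) * X ^ 9 +
      C (-30 : ℚ) * X ^ 10 + C (48 : ℚ) * X ^ 11) (by compute_degree) (by
    simp only [map_add, map_mul, map_pow, aeval_C, aeval_X, eq_ratCast]
    push_cast
    linear_combination ((aeval ζ (derivative (cyclotomic 36 ℚ)))⁻¹ * (-40 + 46 * ζ - 14 * ζ^2 + 15 * ζ^3 - 2 * ζ^4 + 2 * ζ^5 - 40 * ζ^6 +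
        46 * ζ^7 - 44 * ζ^8 + 42 * ζ^9 - 20 * ζ^10 + 11 * ζ^11 - 15 * ζ^12 +
        24 * ζ^13 - 16 * ζ^14 + 18 * ζ^15 - 8 * ζ^16 - 16 * ζ^17 + 27 * ζ^18 -
        54 * ζ^19 - 28 * ζ^20 + 30 * ζ^21 - 56 * ζ^22 + 68 * ζ^23)) * hΦ +
      ((aeval ζ (derivative (cyclotomic 36 ℚ)))⁻¹ * (-40 + 46 * ζ - 14 * ζ^2 + 15 * ζ^3 - 2 * ζ^4 + 2 * ζ^5)) * h36)]
  norm_num [coeff_X_pow, coeff_X, coeff_C, coeff_one]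

/-- `Tr(ζ′sθ^9) = -60` for `ζ′ = ϖ_ABξ, ϖ_AB = π_Aπ_B = −1 + 2ζ³ − 2ζ⁷ + 2ζ⁸ − ζ⁹ − 2ζ¹⁰ + 2ζ¹¹`, `s = √−1 = ζ⁹ = i`, `θ = ζ + ζ⁻¹` (Euler evaluation). research route conditional on HC_CM; not a corollary; Q11.4-sentence-2 already refuted in dim ≥ 3. [folklore] -/
theorem trace_varpiAB_sqrtNegOne_nine [IsCyclotomicExtension {36} ℚ K] (hζ : IsPrimitiveRoot ζ 36) :
    Algebra.trace ℚ K (((-1 + 2 * ζ ^ 3 - 2 * ζ ^ 7 + 2 * ζ ^ 8 - ζ ^ 9 - 2 * ζ ^ 10 + 2 * ζ ^ 11) * (ζ ^ 5 * (aeval ζ (derivative (cyclotomic 36 ℚ)))⁻¹)) * (ζ ^ 9) * (ζ + ζ⁻¹) ^ 9) = -60 := by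
  have h36 : ζ ^ 36 = 1 := hζ.pow_eq_one
  have hΦ := cyc_thirtySix hζ
  rw [trace_of_key hζ (C (-75 : ℚ) + C (48 : ℚ) * X + C (-36 : ℚ) * X ^ 2 + C (33 : ℚ) * X ^ 3 + C (-33 : ℚ) * X ^ 4 +
      C (30 : ℚ) * X ^ 5 + C (33 : ℚ) * X ^ 6 + C (-33 : ℚ) * X ^ 7 + C (36 : ℚ) * X ^ 8 + C (-48 : ℚ) * X ^ 9 +
      C (75 : ℚ) * X ^ 10 + C (-60 : ℚ) * X ^ 11) (by compute_degree) (by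
    simp only [map_add, map_mul, map_pow, aeval_C, aeval_X, eq_ratCast]
    push_cast
    linear_combination ((aeval ζ (derivative (cyclotomic 36 ℚ)))⁻¹ * (-96 + 114 * ζ - 54 * ζ^2 + 61 * ζ^3 - 16 * ζ^4 + 17 * ζ^5 - 98 * ζ^6 +
        116 * ζ^7 - 54 * ζ^8 + 136 * ζ^9 - 64 * ζ^10 + 53 * ζ^11 - 35 * ζ^12 +
        35 * ζ^13 - 31 * ζ^14 + 42 * ζ^15 - 24 * ζ^16 + 2 * ζ^17 + 75 * ζ^18 -
        138 * ζ^19 - ζ^20 - 24 * ζ^21 - 84 * ζ^22 + 98 * ζ^23)) * hΦ +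
      ((aeval ζ (derivative (cyclotomic 36 ℚ)))⁻¹ * (-96 + 114 * ζ - 54 * ζ^2 + 61 * ζ^3 - 16 * ζ^4 + 17 * ζ^5 - 2 * ζ^6 +
        2 * ζ^7)) * h36)]
  norm_num [coeff_X_pow, coeff_X, coeff_C, coeff_one]

/-- `Tr(ζ′sθ^10) = 150` for `ζ′ = ϖ_ABξ, ϖ_AB = π_Aπ_B = −1 + 2ζ³ − 2ζ⁷ + 2ζ⁸ − ζ⁹ − 2ζ¹⁰ + 2ζ¹¹`, `s = √−1 = ζ⁹ = i`, `θ = ζ + ζ⁻¹` (Euler evaluation). research route conditional on HC_CM; not a corollary; Q11.4-sentence-2 already refuted in dim ≥ 3. [folklore] -/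
theorem trace_varpiAB_sqrtNegOne_ten [IsCyclotomicExtension {36} ℚ K] (hζ : IsPrimitiveRoot ζ 36) :
    Algebra.trace ℚ K (((-1 + 2 * ζ ^ 3 - 2 * ζ ^ 7 + 2 * ζ ^ 8 - ζ ^ 9 - 2 * ζ ^ 10 + 2 * ζ ^ 11) * (ζ ^ 5 * (aeval ζ (derivative (cyclotomic 36 ℚ)))⁻¹)) * (ζ ^ 9) * (ζ + ζ⁻¹) ^ 10) = 150 := by
  have h36 : ζ ^ 36 = 1 := hζ.pow_eq_one
  have hΦ := cyc_thirtySix hζ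
  rw [trace_of_key hζ (C (108 : ℚ) + C (-111 : ℚ) * X + C (81 : ℚ) * X ^ 2 + C (-69 : ℚ) * X ^ 3 + C (63 : ℚ) * X ^ 4 +
      C (-75 : ℚ) * X ^ 5 + C (-63 : ℚ) * X ^ 6 + C (69 : ℚ) * X ^ 7 + C (-81 : ℚ) * X ^ 8 + C (111 : ℚ) * X ^ 9 +
      C (-108 : ℚ) * X ^ 10 + C (150 : ℚ) * X ^ 11) (by compute_degree) (by
    simp only [map_add, map_mul, map_pow, aeval_C, aeval_X, eq_ratCast]
    push_cast
    linear_combination ((aeval ζ (derivative (cyclotomic 36 ℚ)))⁻¹ * (-180 + 212 * ζ - 150 * ζ^2 + 175 * ζ^3 - 70 * ζ^4 + 78 * ζ^5 - 198 * ζ^6 +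
        231 * ζ^7 - 152 * ζ^8 + 177 * ζ^9 - 178 * ζ^10 + 189 * ζ^11 - 99 * ζ^12 +
        88 * ζ^13 - 66 * ζ^14 + 77 * ζ^15 - 55 * ζ^16 + 44 * ζ^17 + 135 * ζ^18 -
        234 * ζ^19 + 74 * ζ^20 - 162 * ζ^21 - 85 * ζ^22 + 74 * ζ^23)) * hΦ +
      ((aeval ζ (derivative (cyclotomic 36 ℚ)))⁻¹ * (-180 + 212 * ζ - 150 * ζ^2 + 175 * ζ^3 - 70 * ζ^4 + 78 * ζ^5 - 18 * ζ^6 +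
        19 * ζ^7 - 2 * ζ^8 + 2 * ζ^9)) * h36)]
  norm_num [coeff_X_pow, coeff_X, coeff_C, coeff_one]

/-- **The Gram datum `a` of `(E_ζ′, s)` in the real frame `θ^i` (`i < 6`)** for `ζ′ = ϖ_ABξ, ϖ_AB = π_Aπ_B = −1 + 2ζ³ − 2ζ⁷ + 2ζ⁸ − ζ⁹ − 2ζ¹⁰ + 2ζ¹¹` (type 𝔮₃𝔮₂: `𝔬𝔣₀ = (π_Aπ_B)`, degree 24),
`s = √−1 = ζ⁹ = i`: the integer Hankel matrix `(−Tr(ζ′sθ^{i+j}))ᵢⱼ` (and `b = 0`, part 82 `hb_eq_zero`).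
research route conditional on HC_CM; not a corollary; Q11.4-sentence-2 already refuted in dim ≥ 3. [cite: vanGeemen1994HodgeAV, Lemma 5.2 (2)–(3)] -/
theorem realPart_varpiAB_sqrtNegOne [IsCyclotomicExtension {36} ℚ K] [IsCMField K] (hζ : IsPrimitiveRoot ζ 36)
    {x : Fin 6 → K} (hx : ∀ i, x i = (ζ + ζ⁻¹) ^ (i : ℕ)) {a : Matrix (Fin 6) (Fin 6) ℚ}
    (ha : ∀ i j, a i j = Algebra.trace ℚ K (((-1 + 2 * ζ ^ 3 - 2 * ζ ^ 7 + 2 * ζ ^ 8 - ζ ^ 9 - 2 * ζ ^ 10 + 2 * ζ ^ 11) * (ζ ^ 5 * (aeval ζ (derivative (cyclotomic 36 ℚ)))⁻¹)) * x i * IsCMField.complexConj K ((ζ ^ 9) * x j))) :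
    a = !![-2, 0, -4, 2, -8, 6; 0, -4, 2, -8, 6, -18; -4, 2, -8, 6, -18, 18; 2, -8, 6, -18, 18, -48; -8, 6, -18, 18, -48, 60; 6, -18, 18, -48, 60, -150] := by
  rw [ha_eq (complexConj_sqrtNegOne hζ) (complexConj_thetaFrame hζ hx) ha]
  ext i j
  simp only [Matrix.of_apply, hx, ← pow_add]
  fin_cases i <;> fin_cases j <;> simp [trace_varpiAB_sqrtNegOne_zero hζ, trace_varpiAB_sqrtNegOne_one hζ, trace_varpiAB_sqrtNegOne_two hζ, trace_varpiAB_sqrtNegOne_three hζ, trace_varpiAB_sqrtNegOne_four hζ, trace_varpiAB_sqrtNegOne_five hζ,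
    trace_varpiAB_sqrtNegOne_six hζ, trace_varpiAB_sqrtNegOne_seven hζ, trace_varpiAB_sqrtNegOne_eight hζ, trace_varpiAB_sqrtNegOne_nine hζ, trace_varpiAB_sqrtNegOne_ten hζ]

/-- **`det a = -1536`** for `ζ′ = ϖ_ABξ, ϖ_AB = π_Aπ_B = −1 + 2ζ³ − 2ζ⁷ + 2ζ⁸ − ζ⁹ − 2ζ¹⁰ + 2ζ¹¹`, `s = √−1 = ζ⁹ = i` (frame `θ^i`, `i < 6`). research route conditional on HC_CM; not a corollary; Q11.4-sentence-2 already refuted in dim ≥ 3. [cite: vanGeemen1994HodgeAV, Lemma 5.2 (3)] -/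
theorem det_realPart_varpiAB_sqrtNegOne [IsCyclotomicExtension {36} ℚ K] [IsCMField K] (hζ : IsPrimitiveRoot ζ 36)
    {x : Fin 6 → K} (hx : ∀ i, x i = (ζ + ζ⁻¹) ^ (i : ℕ)) {a : Matrix (Fin 6) (Fin 6) ℚ}
    (ha : ∀ i j, a i j = Algebra.trace ℚ K (((-1 + 2 * ζ ^ 3 - 2 * ζ ^ 7 + 2 * ζ ^ 8 - ζ ^ 9 - 2 * ζ ^ 10 + 2 * ζ ^ 11) * (ζ ^ 5 * (aeval ζ (derivative (cyclotomic 36 ℚ)))⁻¹)) * x i * IsCMField.complexConj K ((ζ ^ 9) * x j))) :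
    a.det = -1536 := by
  rw [realPart_varpiAB_sqrtNegOne hζ hx ha]
  simp [Matrix.det_succ_row_zero, Fin.sum_univ_succ, Fin.succAbove, Matrix.submatrix]
  norm_num

/-! ### §3 Invariance, census form, class: `[−3]` NON-SPLIT = row R3 -/

/-- **For EVERY skew `ζ′` of type `𝔮₃𝔮₂` on `ℤ[ζ₃₆]` (`IsOfType 1 ζ′ 𝔣₀`, `𝔬𝔣₀ = (π_Aπ_B)`, degree `24`; `ζ′ = u·ϖ_ABξ`,
`u` a real unit of norm `1` by THEOREM L (i) at `36`) the Gram determinant of `(E_ζ′, i)` in the frame `θ^i` is `−1536`**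
(they exist on every `ℚ(i)`-balanced `Φ`, part 115): the NON-SPLIT row **R3 = `(3, ℚ(i), 3)`** of pub-hsemireg's TARGET-TABLE (census W6.1.3, `T = {2, 3}`).
research route conditional on HC_CM; not a corollary; Q11.4-sentence-2 already refuted in dim ≥ 3. [cite: vanGeemen1994HodgeAV, Lemma 5.2 (3)–(4) and (5.4.1)] [cite: Shimura1998, §14.3 Prop. 4–5, pp. 103–104] -/
theorem det_realPart_typeAB_sqrtNegOne [IsCyclotomicExtension {36} ℚ K] [IsCMField K]
    (hζ : IsPrimitiveRoot ζ 36) {𝔣₀ : Ideal (𝓞 (maximalRealSubfield K))}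
    (h𝔣₀ : 𝔣₀.map (algebraMap (𝓞 (maximalRealSubfield K)) (𝓞 K)) = Ideal.span {(hζ.toInteger ^ 33 * (1 - hζ.toInteger ^ 4) * (1 - hζ.toInteger ^ 2) * (hζ.toInteger ^ 31 * (1 - hζ.toInteger ^ 9) * (1 - hζ.toInteger)) : 𝓞 K)})
    {ζ' : K} (hζ' : IsCMField.complexConj K ζ' = -ζ')
    (hT : CMTypeLattice.IsOfType (1 : (FractionalIdeal (𝓞 K)⁰ K)ˣ) ζ' 𝔣₀)
    {x : Fin 6 → K} (hx : ∀ i, x i = (ζ + ζ⁻¹) ^ (i : ℕ)) {a : Matrix (Fin 6) (Fin 6) ℚ}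
    (ha : ∀ i j, a i j = Algebra.trace ℚ K (ζ' * x i * IsCMField.complexConj K ((ζ ^ 9) * x j))) :
    a.det = -1536 := by
  obtain ⟨ωb, hωb⟩ := exists_basis_thetaPow hζ
  have hx' : ∀ i, x i = (ωb i : K) := fun i => (hx i).trans (hωb i).symm
  have hg : Nat.totient 36 = 2 * (5 + 1) := by decide
  obtain ⟨-, hreal, hϖ0⟩ := signSet_thirtySix_AB hζ
  rw [prodAB_eq hζ] at hreal hϖ0
  have hP := coe_gen_AB' hζ
  have hsk := complexConj_mul_xi hζ hg hreal
  have h0 := mul_ne_zero hϖ0 (xi_ne_zero hζ 5)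
  have hT₀ := isOfType_one_mul_xi hζ 5 hP h𝔣₀
  rw [det_realPart_eq_of_isOfType ωb (complexConj_sqrtNegOne hζ) hx' (norm_realUnits_pos_thirtySix hζ)
    hsk h0 hζ' hT₀ hT (fun i j => rfl) ha]
  exact det_realPart_varpiAB_sqrtNegOne hζ hx (fun i j => rfl)

open scoped Classical in
/-- **CENSUS FORM** (part 115's existence + the determinant): for every CM type `Φ` of `ℚ(ζ_36)` balanced for `N_K = {7, 11, 19, 23, 31, 35}` (Weil signature `(3,3)`
for `K_d = ℚ(√−1)`) and the type `𝔣₀` above, `ℂ^Φ/Φ(ℤ[ζ_36])` carries a `Φ`-positive divisor of type `(K; Φ; 𝔣₀)`, and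
EVERY such divisor `X_ζ′` has van Geemen Gram determinant `-1536` in the real frame `θ^i`: the NON-SPLIT row **R3 = `(3, ℚ(i), 3)`** of pub-hsemireg's TARGET-TABLE (census W6.1.3, `T = {2, 3}`).
research route conditional on HC_CM; not a corollary; Q11.4-sentence-2 already refuted in dim ≥ 3. [cite: vanGeemen1994HodgeAV, Lemma 5.2 (3)–(4) and (5.4.1)] [cite: Shimura1998, §14.3 Prop. 4–5, pp. 103–104] -/
theorem exists_typeAB_sqrtNegOne_det [IsCyclotomicExtension {36} ℚ K] [IsCMField K]
    (hζ : IsPrimitiveRoot ζ 36) (Φ : CMType K)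
    (hbal : 2 * (SΦ[Φ, ζ] ∩ ({7, 11, 19, 23, 31, 35} : Finset (ZMod 36))).card = (SΦ[Φ, ζ]).card)
    {𝔣₀ : Ideal (𝓞 (maximalRealSubfield K))}
    (h𝔣₀ : 𝔣₀.map (algebraMap (𝓞 (maximalRealSubfield K)) (𝓞 K)) =
      Ideal.span {(hζ.toInteger ^ 33 * (1 - hζ.toInteger ^ 4) * (1 - hζ.toInteger ^ 2) * (hζ.toInteger ^ 31 * (1 - hζ.toInteger ^ 9) * (1 - hζ.toInteger)) : 𝓞 K)}) :
    ∃ ζ' : K, IsCMField.complexConj K ζ' = -ζ' ∧ (∀ φ : Φ.1, 0 < (φ.1 ζ').im) ∧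
      CMTypeLattice.IsOfType (1 : (FractionalIdeal (𝓞 K)⁰ K)ˣ) ζ' 𝔣₀ ∧
      ∀ (x : Fin 6 → K), (∀ i, x i = (ζ + ζ⁻¹) ^ (i : ℕ)) → ∀ a : Matrix (Fin 6) (Fin 6) ℚ,
        (∀ i j, a i j = Algebra.trace ℚ K (ζ' * x i * IsCMField.complexConj K ((ζ ^ 9) * x j))) →
        a.det = -1536 := by
  obtain ⟨ζ', h1, h2, h3⟩ := exists_type_thirtySixAB_sqrt_neg_one hζ Φ hbal h𝔣₀
  exact ⟨ζ', h1, h2, h3, fun x hx a ha => det_realPart_typeAB_sqrtNegOne hζ h𝔣₀ h1 h3 hx ha⟩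

/-- **`[-1536] = [−3] ≠ splitDiscriminantClass 3 1` in `ℚˣ/Nm(ℚ(√−1)ˣ)`** (`3/1536 = ((1 / 32))² + 1·((1 / 32))² ∈ Nm`; the key `[−3] ≠ split` is ring2-b02's R3 key `negThree_ne_split_three_one`):
the type-`𝔮₃𝔮₂` (degree `24`) polarised Weil-type `ℤ[ζ₃₆]`-CM sixfolds lie on the NON-SPLIT row **R3 = `(3, ℚ(i), 3)`** of pub-hsemireg's TARGET-TABLE (census W6.1.3, `T = {2, 3}`).
research route conditional on HC_CM; not a corollary; Q11.4-sentence-2 already refuted in dim ≥ 3. [cite: vanGeemen1994HodgeAV, 5.4 and (5.4.1)] [cite: Serre1973, Ch. III §1] -/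
theorem mk0_det_typeAB_sqrtNegOne :
    (QuotientGroup.mk (Units.mk0 (-1536 : ℚ) (by norm_num)) : weilNormResidueGroup 1) =
        QuotientGroup.mk (Units.mk0 (-3 : ℚ) (by norm_num)) ∧
      (QuotientGroup.mk (Units.mk0 (-3 : ℚ) (by norm_num)) : weilNormResidueGroup 1) ≠
        splitDiscriminantClass 3 1 := by
  constructor
  · rw [QuotientGroup.eq]
    have e : (Units.mk0 (-1536 : ℚ) (by norm_num))⁻¹ * Units.mk0 (-3 : ℚ) (by norm_num) =
        Units.mk0 (((1 / 512)) : ℚ) (by norm_num) := Units.ext (by norm_num)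
    rw [e]
    exact mem_normUnitsSubgroup_of_sq_add_mul_sq _ ((1 / 32) : ℚ) ((1 / 32) : ℚ) (by norm_num)
  · exact Summit.HodgeConjecture.Ring2WeilNormDescent.negThree_ne_split_three_one

end Summit.HodgeConjecture.Ring2WeilCoverage.WeilGramLevel36TypeAB

end
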